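import Literature.MathematicalPhysics.QuantumFieldTheory.Balaban1983to89.B7Eq84Concrete
import Literature.MathematicalPhysics.QuantumFieldTheory.Balaban1983to89.B8Eq178Averages

/-!
# `Balaban1983to89.B8Eq137ConstraintPair` — T. Bałaban, *Spaces of regular gauge field configurations on a lattice and gauge
# fixing conditions*, Commun. Math. Phys. **99** (1985) 75–102 [Balaban1985RegularSpaces] ("B8"), (1.29) ∕ (1.31) ∕ (1.37) AT A PAIR
# WITH EQUAL `k`-TH AVERAGES: the restriction (1.29) «`(\overline{R₀u})ʲ(y) = 1` for `y ∈ Λ_j`» on the gauge transformation of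
# Theorem 4, together with the axial input (1.34) and a COMMON top average, FORCES the top double-bar average of the output's
# perturbation to be EXACTLY `1` — by [Balaban1985Averaging] ("B7") (88): «Ū^k_b(Ū₀^k)_b⁻¹ = (\overline{U′U₀}^k)_b(Ū₀^k)_b⁻¹ = … = (U̿₁^k)_b»

statement-level skeleton of published theorems with citation tags; proofs where landed; nothing here is a claim about the Yang–Mills mass gap

WHY (pub-ymgap Track A, DAG node N16 = NE3, seat `pub-ymgap-dag-n16-b`).  Row NE3's END consumes `PairLandauGaugeB8Avg`, whose
member `dbar` is «`dbavgCovIter L W U₁ k = 1`» for the Landau representative `U₁` of the minimiser pair — the kernel reading of (1.37)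
(`B7Eq92Concrete.dbavgCovIter` = B7 (90)∕(91) `U̿₁ᵏ`; the pub-balaban-gaps census ne∕NE3.md R49–R51 located it as a FRAME CONDITION left
open «(M1): smooth frame normalisation jointly with the Landau step»).  This file shows that in the DAG reading it is FREE: it follows from
Theorem 4's own restriction (1.29) on the gauge transformation (typed `B8Eq119TwistedAxial.Restr129`, = B7 (81) by
`B8Eq178Averages.restr129_iff_uavg`), the axial gauge (1.34) of the INPUT (typed as B7 (67), `B7Eq84Concrete.AxialGauge`) and the
equality of the top averages of the pair — through the tree's certified B7 (84)∕(87)∕(88) (`B7Eq84Concrete.avgIter_eq_of_gauge`).  No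
smallness, no analysis: group algebra.

THE PRINTED TEXT.  B8 p. 81: «Instead of them we will consider the restrictions `(\overline{R₀u})ʲ(y) = 1` for `y ∈ Λ_j`, `j = 0, 1, …, k`,
(1.29) where `\overline{R₀u}ʲ` denotes a `j`-th order averaging operation for gauge transformations, e.g., the operation defined by (79), (80)
in [3].»  p. 82: «Let us denote `B = (1∕i) log Ū₁ʲ`, then `|B| < 2dLα₁ on Λ_j`. (1.31) … `Q_j(U₀, ηA) = B on Λ_j, |B| < 2dLα₁ on Λ_j`,
(1.37)».  p. 88, Theorem 4: «there exists exactly one gauge transformation `u` satisfying (1.29) and such that the conditions (1.37),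
(1.38), (1.62) hold for the configuration `U₁ = U′^{u⁻¹}`.»  B7 p. 30–31: «`(\overline{R₀u}ᵏ)(y) = 1, y ∈ Ω^{(k)}`. (81) …
`(\overline{R₀u}ʲ)(x_j) = u(x_j)\overline{R_{0,x_j}U₁}^{(j)}`, (84) … `u(y) = (\overline{R_{0,y}U₁^{(k)}})⁻¹`. (87) … `Ū^k_b(Ū₀^k)_b⁻¹ =
(\overline{U′U₀}^k)_b(Ū₀^k)_b⁻¹ = … `, (88)», «We are going to prove now the fundamental equality … `= (U̿₁^k)_b`. (92)».

WHAT IS CERTIFIED HERE (kernel; std axioms; the `ℤᵈ` carriers and dictionary of `B7Eq84Concrete` ∕ `B7Eq92Concrete`: `U₀` the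
background, `U₁` the perturbation of the OUTPUT (`U₁·U₀` the gauge-fixed field), `u` the gauge transformation with `U′ = U₁^{u}` in the moving
frame (55) = the INPUT perturbation, `U′·U₀ = (U₁·U₀)^{u}` (`B7Eq92Concrete.mgauge_mul`); B7's `u` is B8's `u` of «`U₁ = U′^{u⁻¹}`»):
* `axialGauge_of_transporters` — DICTIONARY: B7's block axial gauge conditions (67) for `U′ = U₁^{u}` (`B7Eq84Concrete.AxialGauge L U₀ U₁ u k`)
  ARE B8's (1.19) for the input `U′·U₀` in the transporter form `\overline{U′U₀}ʲ(Γ_{Lz,x}) = Ū₀ʲ(Γ_{Lz,x})` (`B8Eq119TwistedAxial`,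
  `B8Eq166ConstraintPair`), `j < k`;
* `uavg_top_of_restr129` — (1.29) with `Λ_k` = the whole top lattice gives B7's (81) `\overline{R₀u}ᵏ ≡ 1` (`restr129_iff_uavg`);
* **`dbavgCovIter_eq_one_of_restr`** — (67) ∧ (81) ∧ `\overline{U′U₀}ᵏ = Ū₀ᵏ` (common top average of the pair) ⟹ **`U̿₁ᵏ = 1`**
  (`dbavgCovIter L U₀ U₁ k = 1`): by (88) `\overline{U′U₀}ᵏ = U̿₁ᵏ·Ū₀ᵏ` and cancellation in the group of units;
* **`dbavgCovIter_eq_one_of_restr129`** — the same from `Restr129 L k Λ U₀ u` with `Λ k = univ` and (1.19) in transporter form;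
HONEST SCOPE.  Pure gauge∕averaging algebra over the tree's B7 objects; nothing of Theorem 4 (existence of the Landau gauge with (1.29)) is
proved; the top-level-only reading `Λ_k = Ω^{(k)}` of (1.29) is the all-small-field case (row NE3); `ℤᵈ` carriers as in the parents.
No `sorry`; axioms `propext`∕`Classical.choice`∕`Quot.sound`.
-/

noncomputable section

open scoped BigOperators
open Finset

namespace Literature.MathematicalPhysics.QuantumFieldTheory.Balaban1983to89.B8Eq137ConstraintPair

open B7Prop1Explicit B7Prop2Explicit B7AvgGaugeCovariance B7Eq92Concrete B7Eq99Concrete B7Eq84Concrete B8Eq119TwistedAxial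
open B8Eq178Averages (restr129_iff_uavg)
export B7Prop1Explicit (Site)

variable {d : ℕ}

variable {𝔸 : Type*} [NormedRing 𝔸] [NormedAlgebra ℂ 𝔸] [CompleteSpace 𝔸]

/-- **DICTIONARY (67) ↔ (1.19)**: B7's block axial gauge conditions for `U′ = U₁^{u}` at the levels `j < k` (`B7Eq84Concrete.AxialGauge`:
`(R̄^j_{0,Lz}Ũ′^j)(Γ_{Lz,x}) = 1`, twisted transport `tHol` of `Ũ′ʲ = \overline{U′U₀}ʲ(Ū₀ʲ)⁻¹`) follow from — indeed are — B8's (1.19) for the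
input field `U′·U₀ = (U₁U₀)^{u}` in the transporter form `\overline{U′U₀}ʲ(Γ_{Lz,x}) = Ū₀ʲ(Γ_{Lz,x})`, `x ∈ B(Lz)`
(`B8Eq119TwistedAxial.covProd_treeWord_eq_one_iff`'s reading). [cite: Balaban1985Averaging, (67) p.29, (69) p.29; Balaban1985RegularSpaces, (1.19) p.79, (1.34) p.82] -/
theorem axialGauge_of_transporters (L : ℕ) (U₀ U₁ : Site d → Fin d → 𝔸ˣ) (u : Site d → 𝔸ˣ) (k : ℕ)
    (h19 : ∀ j, j < k → ∀ (z : Site d) (r : Fin d → Fin L),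
      axialFn (avgIter L (mgauge U₀ u U₁ * U₀) j) ((L : ℤ) • z) ((L : ℤ) • z + boxVec L r) =
        axialFn (avgIter L U₀ j) ((L : ℤ) • z) ((L : ℤ) • z + boxVec L r)) :
    B7Eq84Concrete.AxialGauge L U₀ U₁ u k := by
  intro j hj z r
  have h := h19 j hj z r
  simp only [axialFn, add_sub_cancel_left] at h
  rw [tHol, tildIter_mul, h, mul_inv_cancel]

/-- **(1.29) ⟹ (81)**: the restriction (1.29) with `Λ_k = Ω^{(k)}` (the whole top lattice — the all-small-field case) contains B7's
averaging condition `(\overline{R₀u}ᵏ)(y) = 1` for every `y` (`B8Eq178Averages.restr129_iff_uavg`).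
[cite: Balaban1985RegularSpaces, (1.29) p.81; Balaban1985Averaging, (81) p.30] -/
theorem uavg_top_of_restr129 {L k : ℕ} {Λ : ℕ → Set (Site d)} (hΛ : Λ k = Set.univ) {U₀ : Site d → Fin d → 𝔸ˣ}
    {u : Site d → 𝔸ˣ} (h : Restr129 L k Λ U₀ u) (z : Site d) : uavg L U₀ u k z = 1 :=
  (restr129_iff_uavg L k Λ U₀ u).1 h k le_rfl z (by rw [hΛ]; exact Set.mem_univ z)

/-- **(67) ∧ (81) AT A PAIR WITH EQUAL TOP AVERAGES ⟹ `U̿₁ᵏ = 1`**: if `U′ = U₁^{u}` satisfies the block axial gauge (67) below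
level `k`, `u` the averaging condition (81) at level `k`, and the input `U′·U₀` has the SAME `k`-th average as the background,
`\overline{U′U₀}ᵏ = Ū₀ᵏ`, then the `k`-th double-bar average (90)∕(91) of `U₁` relative to `U₀` is identically `1` — B7 (88)
`\overline{U′U₀}ᵏ = U̿₁ᵏ·Ū₀ᵏ` (`B7Eq84Concrete.avgIter_eq_of_gauge`) and cancellation.  This is B8's (1.31)∕(1.37) datum `B = (1∕i) log Ū₁ᵏ`
being EXACTLY `0` at the top level for a pair in the same constraint set. [cite: Balaban1985Averaging, (88) p.31, (81) p.30; Balaban1985RegularSpaces, (1.37) p.82, (1.29) p.81] -/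
theorem dbavgCovIter_eq_one_of_restr (L : ℕ) (U₀ U₁ : Site d → Fin d → 𝔸ˣ) (u : Site d → 𝔸ˣ) (k : ℕ)
    (hax : B7Eq84Concrete.AxialGauge L U₀ U₁ u k) (h81 : ∀ z : Site d, uavg L U₀ u k z = 1)
    (htop : avgIter L (mgauge U₀ u U₁ * U₀) k = avgIter L U₀ k) :
    dbavgCovIter L U₀ U₁ k = 1 := by
  have h := avgIter_eq_of_gauge L U₀ U₁ u k hax h81
  rw [htop] at h
  funext z κ
  have hz := congrFun (congrFun h z) κ
  rw [Pi.mul_apply] at hz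
  have : dbavgCovIter L U₀ U₁ k z κ * avgIter L U₀ k z κ = 1 * avgIter L U₀ k z κ := by rw [one_mul]; exact hz.symm
  exact mul_right_cancel this

/-- **(1.29) ∧ (1.19) AT A PAIR WITH EQUAL TOP AVERAGES ⟹ `U̿₁ᵏ = 1`** (B8's letters): for a gauge transformation `u` satisfying the
restriction (1.29) with `Λ_k = Ω^{(k)}` and such that the input field `(U₁U₀)^{u} = U′·U₀` is in the axial gauge (1.19) relative to `U₀` at
every block of every level `j < k` and has the same `k`-th average as `U₀`: `dbavgCovIter L U₀ U₁ k = 1`.  At row NE3's minimiser pair this is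
`PairLandauGaugeB8Avg`'s member `dbar` for the Landau perturbation `U₁ = relPert W Z` GIVEN Theorem 4's `Restr` (see `Spine/NE3/PairDbarB8`).
[cite: Balaban1985RegularSpaces, (1.29) p.81, (1.19) p.79, (1.37) p.82, Thm 4 p.88; Balaban1985Averaging, (88) p.31] -/
theorem dbavgCovIter_eq_one_of_restr129 (L : ℕ) (U₀ U₁ : Site d → Fin d → 𝔸ˣ) (u : Site d → 𝔸ˣ) (k : ℕ)
    {Λ : ℕ → Set (Site d)} (hΛ : Λ k = Set.univ) (hres : Restr129 L k Λ U₀ u)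
    (h19 : ∀ j, j < k → ∀ (z : Site d) (r : Fin d → Fin L),
      axialFn (avgIter L (gaugeAct u (U₁ * U₀)) j) ((L : ℤ) • z) ((L : ℤ) • z + boxVec L r) =
        axialFn (avgIter L U₀ j) ((L : ℤ) • z) ((L : ℤ) • z + boxVec L r))
    (htop : avgIter L (gaugeAct u (U₁ * U₀)) k = avgIter L U₀ k) :
    dbavgCovIter L U₀ U₁ k = 1 := by
  rw [← mgauge_mul] at h19 htop
  exact dbavgCovIter_eq_one_of_restr L U₀ U₁ u k (axialGauge_of_transporters L U₀ U₁ u k h19)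
    (uavg_top_of_restr129 hΛ hres) htop

end Literature.MathematicalPhysics.QuantumFieldTheory.Balaban1983to89.B8Eq137ConstraintPair

end
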